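import Mathlib
import Literature.Analysis.FluidPDE.AncientMildCurlCompactness
import Summits.NavierStokesRegularity.OSWSelfSimilar.TypeIIInnerLimitUnitStream
import HarnessLib
/-!
# Type (α) is VELOCITY-DOMINATED: the zoomed vorticity converges, and vanishes in the (α) branch
# (zone Z1 TEMPLATE §T1.4-I (I-4)(α) «all vorticity living at amplitude o(‖u‖²_∞) ((G4): μ_ωu → 0)», (G4)/(C9); kernel)

HONEST FRAMING (cell ns-blowup GROUP B «PROFILE SEARCH», zone Z1; D-0035/D-0074): part XXIX of the Z1 dictionary. (K53)
listed «the (α)-branch consequences beyond W ≡ c — (G4)/(C9) vorticity o(‖u‖²_∞) on the parabolic balls — needs C¹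
convergence of the zoom (the tree's Lemma 6.1 is C⁰_loc)» as NOT TYPED. The tree in fact carries KNSS Lemma 6.1 WITH
POINTWISE CONVERGENCE OF THE VORTICITIES (`Literature.Analysis.FluidPDE.exists_ancientMild_limit_curl_tendsto`,
`AncientMildCurlCompactness`: window-uniform second-derivative bounds (4.10) + Landau's two-function inequality). This
file threads it through the gauge N-a zoom:

* `curl_zoom_slice` — the vorticity has weight 2 under the zoom with centre: `curl(λu(t, x₀ + λ·))(y) =
  λ² (curl u(t))(x₀ + λy)` (part V `curl_modulatedAnsatz` is the centre-free form);
* `zoom_limit_curl_tendsto` — along a FURTHER subsequence, the zoomed vorticity `λₖ² ω(tₖ + λₖ²s, xₖ + λₖy)` converges to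
  `curl W(s)(y)` for every `s < 0`, `y`, where `W` is the inner object the zoom converges to (the curl-limit of the tree's
  lemma is identified with `W` by uniqueness of pointwise limits);
* `zoom_curl_tendsto_zero_of_const` — **(α) ⇒ velocity-dominated**: if the inner object is slice-wise constant, the
  zoomed vorticity tends to `0` at every point of every negative slice — «vorticity o(‖u‖²_∞) in the inner zone»;
* `innerLimit_alternative_with_vorticity_of_singularity` — the sharpened census sentence of part XXVI with the vorticity
  rider: on K8's standing hypotheses verbatim, EITHER (α) `W ≡ c` (unit, `c₁ = 0`) AND `λₖ²ω → 0` pointwise along the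
  subsequence, OR (β) the (AX-L) counterexample with the (I-5) signature (and `λₖ²ω → curl W` pointwise).

**Nothing here asserts that a singular solution exists or that (AX-L) holds or fails.** «violates: n/a — dictionary»;
bears_on LADDER-NS N5/Z1 → N1 linear core / N0⁻ ((I-4)(α), (G4)/(C9)). Author: ns-blowup-profile-eng-1 g8, 2026-08-27.
-/

open Real Filter Topology Set MeasureTheory Function Bornology
open scoped ENNReal NNReal
open Literature.Analysis.FluidPDE

namespace Summit.NavierStokesRegularity.OSWSelfSimilar
namespace TypeIIModulationDictionary

section Vorticity

variable {T Mₛ : ℝ} {u : ℝ → EuclideanSpace ℝ (Fin 3) → EuclideanSpace ℝ (Fin 3)}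
  {p : ℝ → EuclideanSpace ℝ (Fin 3) → ℝ} {W : ℝ → EuclideanSpace ℝ (Fin 3) → EuclideanSpace ℝ (Fin 3)}

/-- **Vorticity has weight 2 under the zoom with centre**: `curl(y ↦ λ u(t₀ + λ²s, x₀ + λy))(y) =
λ² (curl u(t₀ + λ²s))(x₀ + λy)` — TEMPLATE (E2)/(G4): in gauge N-a, `‖curl V‖ = λ²‖ω‖ = ‖ω‖/‖u‖²_∞ = μ_ωu`.
[new here — dictionary] -/
theorem curl_zoom_slice (lam t₀ : ℝ) (x₀ : EuclideanSpace ℝ (Fin 3)) (s : ℝ) (y : EuclideanSpace ℝ (Fin 3)) :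
    curl ((lam • stPull (lam ^ 2) lam t₀ x₀ u) s) y = lam ^ 2 • curl (u (t₀ + lam ^ 2 * s)) (x₀ + lam • y) := by
  have hfun : (lam • stPull (lam ^ 2) lam t₀ x₀ u) s =
      fun y => lam • (fun z => u (t₀ + lam ^ 2 * s) (x₀ + z)) (lam • y) := by
    funext y; simp [stPull_apply]
  rw [hfun, curl_smul_comp_smul (fun z => u (t₀ + lam ^ 2 * s) (x₀ + z)) lam lam y, ← sq]
  congr 1
  rw [curl_eq_curlCLM, curl_eq_curlCLM, fderiv_comp_add_left]

/-- **The zoomed vorticity converges to the vorticity of the inner object (along a further subsequence).** Let `u` be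
classical (`ν = 1`, unforced) on `[0, T⋆) × ℝ³`, bounded with bounded energy on closed sub-slabs; zoom data
`tₖ ∈ [t₁, T⋆)` (`t₁ > 0`), `λₖ > 0`, `λₖ → 0`, `λₖ‖u‖ ≤ 1` on `[0, tₖ]`, any centres `xₖ`; suppose that along `φ` the zoom
converges slice-wise locally uniformly to `W` (any field; in the dictionary, the inner object). Then along a further subsequence `φ ∘ ψ` the ZOOMED
VORTICITY converges pointwise: `λ² (curl u(t + λ²s))(x + λy) → curl W(s)(y)` for every `s < 0`, `y` (the tree's
`exists_ancientMild_limit_curl_tendsto` — KNSS Lemma 6.1 with vorticity — applied to the zoom family, its limit identified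
with `W` by uniqueness of pointwise limits). [new here — dictionary] -/
theorem zoom_limit_curl_tendsto (hu : IsClassicalNSSolutionOn (Ico 0 T) 1 0 u p)
    (hE : ∀ S < T, ∃ C : ℝ≥0∞, C < ⊤ ∧ ∀ t ∈ Icc 0 S, ∫⁻ x, ‖u t x‖ₑ ^ 2 ≤ C)
    (hbdd : ∀ S < T, ∃ N : ℝ, 0 < N ∧ ∀ t ∈ Icc 0 S, ∀ x, ‖u t x‖ ≤ N)
    {tn lamn : ℕ → ℝ} {xn : ℕ → EuclideanSpace ℝ (Fin 3)} {t₁ : ℝ} (ht₁ : 0 < t₁)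
    (htn : ∀ k, t₁ ≤ tn k ∧ tn k < T) (hlam : ∀ k, 0 < lamn k) (hlam0 : Tendsto lamn atTop (𝓝 0))
    (hgauge : ∀ k, ∀ t ∈ Icc 0 (tn k), ∀ x, lamn k * ‖u t x‖ ≤ 1) {φ : ℕ → ℕ} (hφ : StrictMono φ)
    (hconv : ∀ s < 0, TendstoLocallyUniformly
      (fun k => (lamn (φ k) • stPull (lamn (φ k) ^ 2) (lamn (φ k)) (tn (φ k)) (xn (φ k)) u) s) (W s) atTop) :
    ∃ ψ : ℕ → ℕ, StrictMono ψ ∧ ∀ s < 0, ∀ y : EuclideanSpace ℝ (Fin 3),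
      Tendsto (fun j => lamn (φ (ψ j)) ^ 2 •
        curl (u (tn (φ (ψ j)) + lamn (φ (ψ j)) ^ 2 * s)) (xn (φ (ψ j)) + lamn (φ (ψ j)) • y)) atTop
        (𝓝 (curl (W s) y)) := by
  -- the zoom family along `φ`, its windows `(A, B)`
  set w : ℕ → ℝ → EuclideanSpace ℝ (Fin 3) → EuclideanSpace ℝ (Fin 3) :=
    fun k => lamn (φ k) • stPull (lamn (φ k) ^ 2) (lamn (φ k)) (tn (φ k)) (xn (φ k)) u with hw_def
  set A : ℕ → ℝ := fun k => -tn (φ k) / lamn (φ k) ^ 2 with hA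
  set B : ℕ → ℝ := fun k => (T - tn (φ k)) / lamn (φ k) ^ 2 with hB
  have hlamφ : ∀ k, 0 < lamn (φ k) := fun k => hlam (φ k)
  have hBpos : ∀ k, 0 < B k := fun k => div_pos (sub_pos.2 (htn (φ k)).2) (pow_pos (hlamφ k) 2)
  have hAlim : Tendsto A atTop atBot := by
    have hl0 : Tendsto (fun k => lamn (φ k)) atTop (𝓝 0) := hlam0.comp hφ.tendsto_atTop
    have hl2 : Tendsto (fun k => lamn (φ k) ^ 2) atTop (𝓝[>] 0) := by
      refine tendsto_nhdsWithin_iff.2 ⟨by simpa using hl0.pow 2, Eventually.of_forall fun k => ?_⟩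
      exact pow_pos (hlamφ k) 2
    have hinv : Tendsto (fun k => (lamn (φ k) ^ 2)⁻¹) atTop atTop := tendsto_inv_nhdsGT_zero.comp hl2
    have hmaj : Tendsto (fun k => -t₁ * (lamn (φ k) ^ 2)⁻¹) atTop atBot :=
      hinv.const_mul_atTop_of_neg (by linarith)
    refine tendsto_atBot_mono (fun k => ?_) hmaj
    have hl2k : 0 < lamn (φ k) ^ 2 := pow_pos (hlamφ k) 2
    show -tn (φ k) / lamn (φ k) ^ 2 ≤ -t₁ * (lamn (φ k) ^ 2)⁻¹
    rw [div_eq_mul_inv]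
    exact mul_le_mul_of_nonneg_right (by linarith [(htn (φ k)).1]) (inv_nonneg.2 hl2k.le)
  have hcl : ∀ k, IsClassicalNSSolutionOn (Ioo (A k) (B k)) 1 0 (w k)
      (lamn (φ k) ^ 2 • stPull (lamn (φ k) ^ 2) (lamn (φ k)) (tn (φ k)) (xn (φ k)) p) :=
    fun k => zoom_isClassical hu (hlamφ k) (tn (φ k)) (xn (φ k))
  have hsub : ∀ k, Ioo (A k) 0 ⊆ Ioo (A k) (B k) := fun k => Ioo_subset_Ioo le_rfl (hBpos k).le
  have hcont : ∀ k, ContinuousOn (uncurry (w k)) (Ioo (A k) 0 ×ˢ univ) := fun k =>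
    (hcl k).smooth_velocity.continuousOn.mono (prod_mono (hsub k) Subset.rfl)
  have hdiv : ∀ k, ∀ t ∈ Ioo (A k) 0, IsWeaklyDivFree (w k t) := fun k t ht =>
    VectorCalculus.IsDivFree.isWeaklyDivFree_holds ((hcl k).divFree t (hsub k ht))
      (contDiff_infty.1 ((hcl k).contDiff_velocity (hsub k ht)) 1)
  have hmild : ∀ k, ∀ s t : ℝ, A k < s → s < t → t < 0 → ∀ x,
      w k t x = Literature.Analysis.UnboundedOperators.heatExtension (w k s) (t - s) x -
        oseenDuhamel 1 s (w k) (w k) t x :=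
    fun k s t hs hst ht x => zoom_oseenMild hu hE hbdd (hlamφ k) (tn (φ k)) (xn (φ k)) hs hst (ht.trans (hBpos k)) x
  have hbd1 : ∀ k, ∀ τ ∈ Ioo (A k) 0, ∀ x, ‖w k τ x‖ ≤ 1 := by
    intro k τ hτ x
    have hl2k : 0 < lamn (φ k) ^ 2 := pow_pos (hlamφ k) 2
    have h1 : 0 ≤ tn (φ k) + lamn (φ k) ^ 2 * τ := by
      have : -tn (φ k) / lamn (φ k) ^ 2 < τ := hτ.1
      rw [div_lt_iff₀ hl2k] at this; linarith
    have h2 : tn (φ k) + lamn (φ k) ^ 2 * τ ≤ tn (φ k) := by nlinarith [hτ.2]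
    have h := hgauge (φ k) (tn (φ k) + lamn (φ k) ^ 2 * τ) ⟨h1, h2⟩ (xn (φ k) + lamn (φ k) • x)
    simpa [hw_def, stPull_apply, norm_smul, abs_of_pos (hlamφ k)] using h
  -- the tree's Lemma 6.1 with vorticity, applied to the zoom family
  obtain ⟨ψ, W₂, hψ, -, -, -, -, -, -, hpt₂, hcurl₂⟩ :=
    exists_ancientMild_limit_curl_tendsto (B := 1) hAlim hcont hdiv hmild hbd1
  -- identification of the two limits on negative slices
  have hWW : ∀ s < 0, W₂ s = W s := by
    intro s hs
    funext y
    have h1 : Tendsto (fun j => w (ψ j) s y) atTop (𝓝 (W s y)) :=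
      (((hconv s hs).tendstoLocallyUniformlyOn (s := univ)).tendsto_at (mem_univ y)).comp hψ.tendsto_atTop
    exact tendsto_nhds_unique (hpt₂ s hs y) h1
  refine ⟨ψ, hψ, fun s hs y => ?_⟩
  have h := hcurl₂ s hs y
  rw [hWW s hs] at h
  refine h.congr fun j => ?_
  simp only [hw_def]
  exact curl_zoom_slice _ _ _ _ _

/-- **(α) ⇒ VELOCITY-DOMINATED: the zoomed vorticity tends to zero.** Under the hypotheses of `zoom_limit_curl_tendsto`, if
the inner object is constant in space on every slice (type (I-4)(α)), then along the further subsequence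
`λ² (curl u(t + λ²s))(x + λy) → 0` for every `s < 0`, `y` — in gauge N-a, `‖curl V‖ = ‖ω‖/‖u‖²_∞ → 0` pointwise on the
parabolic cylinders around the near-max centres: «all vorticity living at amplitude o(‖u‖²_∞)» (TEMPLATE (I-4)(α),
(G4)/(C9)). [new here — dictionary] -/
theorem zoom_curl_tendsto_zero_of_const (hu : IsClassicalNSSolutionOn (Ico 0 T) 1 0 u p)
    (hE : ∀ S < T, ∃ C : ℝ≥0∞, C < ⊤ ∧ ∀ t ∈ Icc 0 S, ∫⁻ x, ‖u t x‖ₑ ^ 2 ≤ C)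
    (hbdd : ∀ S < T, ∃ N : ℝ, 0 < N ∧ ∀ t ∈ Icc 0 S, ∀ x, ‖u t x‖ ≤ N)
    {tn lamn : ℕ → ℝ} {xn : ℕ → EuclideanSpace ℝ (Fin 3)} {t₁ : ℝ} (ht₁ : 0 < t₁)
    (htn : ∀ k, t₁ ≤ tn k ∧ tn k < T) (hlam : ∀ k, 0 < lamn k) (hlam0 : Tendsto lamn atTop (𝓝 0))
    (hgauge : ∀ k, ∀ t ∈ Icc 0 (tn k), ∀ x, lamn k * ‖u t x‖ ≤ 1) {φ : ℕ → ℕ} (hφ : StrictMono φ)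
    (hconv : ∀ s < 0, TendstoLocallyUniformly
      (fun k => (lamn (φ k) • stPull (lamn (φ k) ^ 2) (lamn (φ k)) (tn (φ k)) (xn (φ k)) u) s) (W s) atTop)
    (hconst : ∀ s < 0, ∀ y : EuclideanSpace ℝ (Fin 3), W s y = W s 0) :
    ∃ ψ : ℕ → ℕ, StrictMono ψ ∧ ∀ s < 0, ∀ y : EuclideanSpace ℝ (Fin 3),
      Tendsto (fun j => lamn (φ (ψ j)) ^ 2 •
        curl (u (tn (φ (ψ j)) + lamn (φ (ψ j)) ^ 2 * s)) (xn (φ (ψ j)) + lamn (φ (ψ j)) • y)) atTop (𝓝 0) := by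
  obtain ⟨ψ, hψ, hcurl⟩ := zoom_limit_curl_tendsto hu hE hbdd ht₁ htn hlam hlam0 hgauge hφ hconv
  refine ⟨ψ, hψ, fun s hs y => ?_⟩
  have hc : W s = fun _ => W s 0 := funext (hconst s hs)
  have h0 : curl (W s) y = 0 := by rw [hc, curl_eq_curlCLM, fderiv_const_apply, map_zero]
  simpa [h0] using hcurl s hs y

/-- **THE SHARPENED Z1 CENSUS SENTENCE WITH THE VORTICITY RIDER (unconditional).** On K8's standing hypotheses verbatim —
`IsMaximalSmoothSolution 1 0 u p T⋆` (`T⋆ > 0`), `IsLerayHopfOn T⋆ 1 0 (u 0) u`, bounded on every closed sub-slab,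
axisymmetric slices, `|Γ(0, ·)| ≤ Mₛ` — there are gauge N-a zoom data and a subsequence along which the zoom converges
slice-wise locally uniformly to a KNSS blow-up limit `W` (with the Oseen identity) AND THE ZOOMED VORTICITY
`λₖ² ω(tₖ + λₖ²s, cₖ + λₖy)` CONVERGES POINTWISE to `curl W(s)(y)`, such that EITHER
(α) `W ≡ c`, `‖c‖ = 1`, `c₁ = 0`, and the zoomed vorticity tends to `0` at every `(s, y)`, `s < 0` — the VELOCITY-DOMINATED
scenario of (I-4)(α)/(G4): `μ_ωu → 0` locally; OR
(β) `AxisymmetricLiouvilleBoundedSwirl` FAILS, witnessed by `W` with the (I-5) signature (part XXVI). [new here —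
dictionary; unconditional] -/
theorem innerLimit_alternative_with_vorticity_of_singularity (hT : 0 < T) (hmax : IsMaximalSmoothSolution 1 0 u p T)
    (hLH : IsLerayHopfOn T 1 0 (u 0) u) (hbdd : ∀ S < T, ∃ N : ℝ, 0 < N ∧ ∀ t ∈ Icc 0 S, ∀ x, ‖u t x‖ ≤ N)
    (haxi : ∀ t, IsAxisymmetric (u t)) (hMₛ : ∀ x, |swirl (u 0) x| ≤ Mₛ) :
    ∃ (tn lamn : ℕ → ℝ) (cn : ℕ → EuclideanSpace ℝ (Fin 3)) (φ : ℕ → ℕ)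
      (W : ℝ → EuclideanSpace ℝ (Fin 3) → EuclideanSpace ℝ (Fin 3)),
      (∀ k, T / 2 ≤ tn k ∧ tn k < T) ∧ (∀ k, 0 < lamn k) ∧ Tendsto lamn atTop (𝓝 0) ∧
      (∀ k, ∀ t ∈ Icc 0 (tn k), ∀ x, lamn k * ‖u t x‖ ≤ 1) ∧ StrictMono φ ∧ IsKNSSBlowupLimit W ∧
      (∀ s < 0, TendstoLocallyUniformly
        (fun k => (lamn (φ k) • stPull (lamn (φ k) ^ 2) (lamn (φ k)) (tn (φ k)) (cn (φ k)) u) s) (W s) atTop) ∧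
      (∀ s t : ℝ, s < t → t < 0 → ∀ x,
        W t x = Literature.Analysis.UnboundedOperators.heatExtension (W s) (t - s) x - oseenDuhamel 1 s W W t x) ∧
      (∀ s < 0, ∀ y : EuclideanSpace ℝ (Fin 3), Tendsto (fun j => lamn (φ j) ^ 2 •
        curl (u (tn (φ j) + lamn (φ j) ^ 2 * s)) (cn (φ j) + lamn (φ j) • y)) atTop (𝓝 (curl (W s) y))) ∧
      ((∃ c : EuclideanSpace ℝ (Fin 3), ‖c‖ = 1 ∧ c 1 = 0 ∧ (∀ s < 0, ∀ y : EuclideanSpace ℝ (Fin 3), W s y = c) ∧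
          ∀ s < 0, ∀ y : EuclideanSpace ℝ (Fin 3), Tendsto (fun j => lamn (φ j) ^ 2 •
            curl (u (tn (φ j) + lamn (φ j) ^ 2 * s)) (cn (φ j) + lamn (φ j) • y)) atTop (𝓝 0)) ∨
        (¬ Summit.NavierStokesRegularity.NavierStokesRegularity.AxisymmetricLiouvilleBoundedSwirl ∧
          (∀ s < 0, IsAxisymmetric (W s)) ∧ (∀ s < 0, ∀ y : EuclideanSpace ℝ (Fin 3), |swirl (W s) y| ≤ Mₛ) ∧
          (∃ s < 0, ∃ x : EuclideanSpace ℝ (Fin 3), W s x ≠ W s 0) ∧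
          (∃ s < 0, ∃ x : EuclideanSpace ℝ (Fin 3), swirl (W s) x ≠ 0) ∧
          (∀ C : ℝ, ∃ s < 0, ∃ x : EuclideanSpace ℝ (Fin 3), C < cylRadius x * ‖poloidalPart (W s) x‖) ∧
          (∀ q : ℝ≥0∞, 1 ≤ q → q < ⊤ → ∀ K : ℝ≥0, ∃ s < 0, (K : ℝ≥0∞) < eLpNorm (swirl (W s)) q volume) ∧
          ∃ ε : ℝ, 0 < ε ∧ ∀ R : ℝ, ∃ s < 0, ∃ x : EuclideanSpace ℝ (Fin 3),
            R ≤ cylRadius x ∧ ε < |swirl (W s) x|)) := by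
  have hT2 : 0 < T / 2 := by positivity
  have hE := energyBound_of_lerayHopf hLH
  obtain ⟨tn, lamn, cn, φ, W, htn, hlam, hlam0, hgauge, hφ, hW, hconv, hmild, halt⟩ :=
    innerLimit_unitStream_or_counterexample_of_singularity hT hmax hLH hbdd haxi hMₛ
  -- refine the subsequence so that the vorticities converge too
  obtain ⟨ψ, hψ, hcurl⟩ := zoom_limit_curl_tendsto hmax.1 hE hbdd (xn := cn) hT2 htn hlam hlam0 hgauge hφ hconv
  have hconv' : ∀ s < 0, TendstoLocallyUniformly
      (fun k => (lamn (φ (ψ k)) • stPull (lamn (φ (ψ k)) ^ 2) (lamn (φ (ψ k))) (tn (φ (ψ k))) (cn (φ (ψ k))) u) s)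
      (W s) atTop := by
    intro s hs v hv y
    obtain ⟨t, ht, hev⟩ := hconv s hs v hv y
    exact ⟨t, ht, hψ.tendsto_atTop.eventually hev⟩
  refine ⟨tn, lamn, cn, φ ∘ ψ, W, htn, hlam, hlam0, hgauge, hφ.comp hψ, hW, hconv', hmild, hcurl, ?_⟩
  rcases halt with ⟨c, hc1, hc0, hc⟩ | hβ
  · refine Or.inl ⟨c, hc1, hc0, hc, fun s hs y => ?_⟩
    have hcs : W s = fun _ => c := funext (hc s hs)
    have h0 : curl (W s) y = 0 := by rw [hcs, curl_eq_curlCLM, fderiv_const_apply, map_zero]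
    simpa [h0] using hcurl s hs y
  · exact Or.inr hβ

end Vorticity

end TypeIIModulationDictionary
end Summit.NavierStokesRegularity.OSWSelfSimilar
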